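import Literature.Topology.FourManifolds.CappedBallLid
import Literature.Topology.FourManifolds.SweepLemma
import Literature.Topology.FourManifolds.RadialBallMap
import Mathlib.Analysis.Calculus.InverseFunctionTheorem.ContDiff
import Mathlib.Topology.Order.Monotone
import HarnessLib

/-!
# The dome model: an explicit convex solid agreeing with the lidded ball near its lid

Topic `Literature/Topology/FourManifolds`; the explicit model `M` of the thick alignment step in
the proof of the smooth Schönflies theorem (Schultens, *Introduction to 3-Manifolds* (2014),
Thm. 3.2.5 with Lemma 3.2.3).  With the lid function `G = a ⊔ b` of `CappedBallLid.lean`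
(`a = x₂ - s(1 - ρ²)` the dome argument, `b = ρ² - (1 + r(x₂))²` the rim argument, smooth maximum
of parameter `κ = s/8`), put

* `b' = ρ² - (1 + s)²` (the rim radius frozen at its top value `s`; `b' = b` for `x₂ ≥ -2s`),
  `G' = a ⊔ b'`, the bottom argument `β = -s - x₂`, and **`F_M = G' ⊔ β`**;
* `p₀ = (0, 0, -s/2)`.

Then `M = {F_M ≤ 0}` is the lid solid cut off smoothly at height `≈ -s`; it agrees with the
lidded solid `{G ≤ 0}` on `{x₂ > -s/2}` (§3), contains the ball of radius `s/8` about `p₀`,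
lies in the ball of radius `3`, and — the key point — **every zero of `F_M` is radially
transversal from `p₀`**: `DF_M(x)[x - p₀] > 0` (§2, `fderiv_FM_apply_sub_pos`).  Consequently
(`DomeModelRadial.lean`) the radial function of `∂M` about `p₀` is smooth and `M` is the image of
the closed unit ball under an explicit diffeomorphism (`RadialBallMap.lean`).  Moreover the
conormal `DF_M = A dx₂ + B dρ²` has `B ≥ 0` (§2), which gives the model form of the sweep
hypothesis H3 (`SweepFace.fderiv_wstd_ne_smul`).

## References
* J. Schultens, *Introduction to 3-Manifolds*, GSM 151, AMS (2014), Thm. 3.2.5, Lemma 3.2.3.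
-/

noncomputable section

open Set Metric Filter Topology
open scoped ContDiff Manifold

namespace Literature.Topology.FourManifolds.DomeModel

open CappedBallLid

variable {P : ℝ → ℝ} {s : ℝ}

/-! ### §1 Definitions and values -/

/-- The frozen rim argument `b' = ρ² - (1+s)²`. [folklore] -/
def rimFun' (s : ℝ) (x : EuclideanSpace ℝ (Fin 3)) : ℝ := hsq x - (1 + s) ^ 2

/-- The frozen lid function `G' = a ⊔_κ b'`. [folklore] -/
def lid' (P : ℝ → ℝ) (s : ℝ) (x : EuclideanSpace ℝ (Fin 3)) : ℝ :=
  topFun s x + s / 8 * P ((rimFun' s x - topFun s x) / (s / 8))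

/-- The bottom argument `β = -s - x₂`. [folklore] -/
def bot (s : ℝ) (x : EuclideanSpace ℝ (Fin 3)) : ℝ := -s - x 2

/-- **The model function** `F_M = G' ⊔_κ β`. [cite: Schultens2014, proof of Thm. 3.2.5 (PDF p. 45)] -/
def FM (P : ℝ → ℝ) (s : ℝ) (x : EuclideanSpace ℝ (Fin 3)) : ℝ :=
  lid' P s x + s / 8 * P ((bot s x - lid' P s x) / (s / 8))

/-- The centre `p₀ = (0, 0, -s/2)`. [folklore] -/
def p0 (s : ℝ) : EuclideanSpace ℝ (Fin 3) := EuclideanSpace.single (2 : Fin 3) (-(s / 2))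

/-- `(p₀)₂ = -s/2`. [folklore] -/
@[simp] theorem p0_apply_two : (p0 s) 2 = -(s / 2) := by simp [p0]
/-- `(p₀)₀ = 0`. [folklore] -/
@[simp] theorem p0_apply_zero : (p0 s) 0 = 0 := by simp [p0]
/-- `(p₀)₁ = 0`. [folklore] -/
@[simp] theorem p0_apply_one : (p0 s) 1 = 0 := by simp [p0]

/-- `ρ²(p₀) = 0`. [folklore] -/
theorem hsq_p0 : hsq (p0 s) = 0 := by simp [hsq]

/-- For `x₂ ≥ -2s` the frozen lid function is the lid function. [folklore] -/
theorem lid'_eq_lidFun (hs : 0 < s) {x : EuclideanSpace ℝ (Fin 3)} (hz : -2 * s ≤ x 2) :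
    lid' P s x = lidFun P s x := by
  have : rimFun s x = rimFun' s x := by
    unfold rimFun rimFun'; rw [rimRadius_eq_self hs hz]
  unfold lid' lidFun; rw [this]

section Values

variable (hPge : ∀ t, max 0 t ≤ P t) (hPle : ∀ t, P t ≤ max 0 t + 1)
include hPge hPle

/-- `max(a, b') ≤ G' ≤ max(a, b') + κ`. [folklore] -/
theorem lid'_bounds (hs : 0 < s) (x : EuclideanSpace ℝ (Fin 3)) :
    max (topFun s x) (rimFun' s x) ≤ lid' P s x ∧ lid' P s x ≤ max (topFun s x) (rimFun' s x) + s / 8 :=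
  ⟨SmoothMax.max_le_smax hPge (by positivity) _ _, SmoothMax.smax_le_max_add hPle (by positivity) _ _⟩

/-- `max(G', β) ≤ F_M ≤ max(G', β) + κ`. [folklore] -/
theorem FM_bounds (hs : 0 < s) (x : EuclideanSpace ℝ (Fin 3)) :
    max (lid' P s x) (bot s x) ≤ FM P s x ∧ FM P s x ≤ max (lid' P s x) (bot s x) + s / 8 :=
  ⟨SmoothMax.max_le_smax hPge (by positivity) _ _, SmoothMax.smax_le_max_add hPle (by positivity) _ _⟩

/-- **Near the centre the model function is negative**: `F_M(x) ≤ -s/8` whenever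
`‖x - p₀‖ ≤ s/8` (`s ≤ 1/8`). [folklore] -/
theorem FM_le_of_near (hs : 0 < s) (hs1 : s ≤ 1 / 8) {x : EuclideanSpace ℝ (Fin 3)}
    (hx : ‖x - p0 s‖ ≤ s / 8) : FM P s x ≤ -(s / 8) := by
  -- coordinates of `x` near `p₀`
  have hc : ∀ i, |(x - p0 s) i| ≤ s / 8 := fun i =>
    le_trans (by simpa using PiLp.norm_apply_le (x - p0 s) i) hx
  have h2 := hc 2
  have h0 := hc 0
  have h1 := hc 1
  simp only [PiLp.sub_apply, p0_apply_two, p0_apply_zero, p0_apply_one, sub_zero, sub_neg_eq_add] at h2 h0 h1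
  rw [abs_le] at h2 h0 h1
  have hh : hsq x ≤ s ^ 2 / 32 := by
    unfold hsq; nlinarith [sq_abs (x 0), sq_abs (x 1), abs_le.2 h0, abs_le.2 h1]
  have htop : topFun s x ≤ -(5 * s / 4) + s ^ 3 / 32 := by
    unfold topFun; nlinarith
  have hrim : rimFun' s x ≤ -1 := by
    unfold rimFun'; nlinarith
  have hbot : bot s x ≤ -(3 * s / 8) := by
    unfold bot; linarith
  have hl := (lid'_bounds hPge hPle hs x).2
  have hF := (FM_bounds hPge hPle hs x).2
  have hm1 : max (topFun s x) (rimFun' s x) ≤ -(5 * s / 4) + s ^ 3 / 32 :=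
    max_le htop (by nlinarith [hs1, hrim])
  have hs3 : s ^ 3 ≤ s := by nlinarith [hs1, hs]
  have hlid : lid' P s x ≤ -(3 * s / 8) := by nlinarith [hm1, hl, hs3]
  have hm2 : max (lid' P s x) (bot s x) ≤ -(3 * s / 8) := max_le hlid hbot
  linarith

/-- `F_M(p₀) < 0`. [folklore] -/
theorem FM_p0_neg (hs : 0 < s) (hs1 : s ≤ 1 / 8) : FM P s (p0 s) < 0 := by
  have := FM_le_of_near hPge hPle hs hs1 (x := p0 s) (by simp; positivity)
  linarith

/-- **Coercivity**: `F_M(x) ≥ max(|x₂| - s, ρ² - (1+s)²)`. [folklore] -/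
theorem le_FM (hs : 0 < s) (x : EuclideanSpace ℝ (Fin 3)) :
    max (|x 2| - s) (hsq x - (1 + s) ^ 2) ≤ FM P s x := by
  have h1 := (lid'_bounds hPge hPle hs x).1
  have h2 := (FM_bounds hPge hPle hs x).1
  have ht : topFun s x ≥ x 2 - s := by unfold topFun; nlinarith [hsq_nonneg x]
  have hb : bot s x = -s - x 2 := rfl
  refine max_le ?_ ?_
  · rcases le_or_gt 0 (x 2) with hz | hz
    · rw [abs_of_nonneg hz]
      exact le_trans (le_trans (by linarith) (le_max_left _ _ |>.trans h1)) (le_max_left _ _ |>.trans h2)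
    · rw [abs_of_neg hz]
      exact le_trans (by rw [hb]; linarith) (le_max_right _ _ |>.trans h2)
  · exact le_trans (le_trans (le_max_right _ _) h1) (le_max_left _ _ |>.trans h2)

/-- **Far from the centre the model function is positive**: `F_M(p₀ + t w0) > 0` for `‖ω‖ = 1`,
`t ≥ 3` (`s ≤ 1/8`). [folklore] -/
theorem FM_pos_of_far (hs : 0 < s) (hs1 : s ≤ 1 / 8) {w0 : EuclideanSpace ℝ (Fin 3)} (hw0 : ‖w0‖ = 1)
    {t : ℝ} (ht : 3 ≤ t) : 0 < FM P s (p0 s + t • w0) := by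
  have hcoer := le_FM hPge hPle hs (p0 s + t • w0)
  have hsq1 : w0 0 ^ 2 + w0 1 ^ 2 + w0 2 ^ 2 = 1 := by
    have h := EuclideanSpace.norm_eq w0
    rw [hw0] at h
    have h' := congrArg (· ^ 2) h
    simp only [one_pow, Real.sq_sqrt (Finset.sum_nonneg fun i _ => sq_nonneg _)] at h'
    simp [Fin.sum_univ_three, Real.norm_eq_abs, sq_abs] at h'
    linarith
  have hz : (p0 s + t • w0) 2 = -(s / 2) + t * w0 2 := by simp
  have hh : hsq (p0 s + t • w0) = t ^ 2 * (w0 0 ^ 2 + w0 1 ^ 2) := by simp [hsq]; ring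
  by_cases hω2 : 1 / 2 ≤ w0 2 ^ 2
  · -- vertical directions: `|x₂| - s > 0`
    have hbig : s < |(p0 s + t • w0) 2| := by
      rw [hz]
      have hprod : 4 ≤ (t * w0 2) ^ 2 := by rw [mul_pow]; nlinarith
      rcases le_or_gt 0 (t * w0 2) with hp | hp
      · have : 2 ≤ t * w0 2 := by nlinarith
        rw [abs_of_pos (by linarith)]; linarith
      · have : t * w0 2 ≤ -2 := by nlinarith
        rw [abs_of_neg (by linarith)]; linarith
    have := le_trans (le_max_left _ _) hcoer
    linarith
  · push Not at hω2
    have hh' : 1 / 2 < w0 0 ^ 2 + w0 1 ^ 2 := by linarith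
    have : (1 + s) ^ 2 < hsq (p0 s + t • w0) := by rw [hh]; nlinarith
    have := le_trans (le_max_right _ _) hcoer
    linarith

end Values

/-! ### §2 Smoothness, the conormal, radial transversality -/

/-- `b'` is smooth with `db' = dρ²`. [folklore] -/
theorem hasFDerivAt_rimFun' (x : EuclideanSpace ℝ (Fin 3)) : HasFDerivAt (rimFun' s) (dhsq x) x := by
  unfold rimFun'; exact (hasFDerivAt_hsq x).sub_const _

/-- `β` is smooth with `dβ = -dx₂`. [folklore] -/
theorem hasFDerivAt_bot (x : EuclideanSpace ℝ (Fin 3)) :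
    HasFDerivAt (bot s) (-(EuclideanSpace.proj (𝕜 := ℝ) (2 : Fin 3))) x := by
  unfold bot
  have := (hasFDerivAt_coord 2 x).const_sub (-s)
  exact this

/-- `G'` is smooth. [folklore] -/
theorem contDiff_lid' (hP : ContDiff ℝ ∞ P) : ContDiff ℝ ∞ (lid' P s) := by
  unfold lid'
  exact SmoothMax.contDiff_smax hP contDiff_topFun (contDiff_hsq.sub contDiff_const)

/-- `F_M` is smooth. [folklore] -/
theorem contDiff_FM (hP : ContDiff ℝ ∞ P) : ContDiff ℝ ∞ (FM P s) := by
  unfold FM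
  exact SmoothMax.contDiff_smax hP (contDiff_lid' hP) (contDiff_const.sub (contDiff_coord 2))

/-- The weight `θ₁ = P'((b' - a)/κ)` of the lid maximum. [folklore] -/
def th1 (P : ℝ → ℝ) (s : ℝ) (x : EuclideanSpace ℝ (Fin 3)) : ℝ :=
  deriv P ((rimFun' s x - topFun s x) / (s / 8))

/-- The weight `θ₂ = P'((β - G')/κ)` of the outer maximum. [folklore] -/
def th2 (P : ℝ → ℝ) (s : ℝ) (x : EuclideanSpace ℝ (Fin 3)) : ℝ :=
  deriv P ((bot s x - lid' P s x) / (s / 8))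

/-- **Derivative of `G'`**: `DG' = (1-θ₁) dx₂ + ((1-θ₁)s + θ₁) dρ²`. [folklore] -/
theorem hasFDerivAt_lid' (hPd : Differentiable ℝ P) (hs : 0 < s) (x : EuclideanSpace ℝ (Fin 3)) :
    HasFDerivAt (lid' P s)
      ((1 - th1 P s x) • EuclideanSpace.proj (𝕜 := ℝ) (2 : Fin 3) +
        ((1 - th1 P s x) * s + th1 P s x) • dhsq x) x := by
  have h := SmoothMax.hasFDerivAt_smax (P := P) (δ := s / 8) hPd (by positivity)
    (hasFDerivAt_topFun (s := s) x) (hasFDerivAt_rimFun' (s := s) x)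
  refine (h.congr_fderiv ?_)
  simp only [th1]
  rw [smul_add, smul_smul, add_smul, mul_comm _ s]
  abel_nf

/-- **Derivative of `F_M`**: `DF_M = A dx₂ + B dρ²` with `A = (1-θ₂)(1-θ₁) - θ₂`,
`B = (1-θ₂)((1-θ₁)s + θ₁)`. [folklore] -/
theorem hasFDerivAt_FM (hPd : Differentiable ℝ P) (hs : 0 < s) (x : EuclideanSpace ℝ (Fin 3)) :
    HasFDerivAt (FM P s)
      (((1 - th2 P s x) * (1 - th1 P s x) - th2 P s x) • EuclideanSpace.proj (𝕜 := ℝ) (2 : Fin 3) +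
        ((1 - th2 P s x) * ((1 - th1 P s x) * s + th1 P s x)) • dhsq x) x := by
  have h := SmoothMax.hasFDerivAt_smax (P := P) (δ := s / 8) hPd (by positivity)
    (hasFDerivAt_lid' hPd hs x) (hasFDerivAt_bot (s := s) x)
  refine (h.congr_fderiv ?_)
  simp only [th2]
  module

/-- The weights lie in `[0, 1]`. [folklore] -/
theorem th_mem (hPd' : ∀ t, 0 ≤ deriv P t ∧ deriv P t ≤ 1) (x : EuclideanSpace ℝ (Fin 3)) :
    (0 ≤ th1 P s x ∧ th1 P s x ≤ 1) ∧ (0 ≤ th2 P s x ∧ th2 P s x ≤ 1) :=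
  ⟨hPd' _, hPd' _⟩

/-- **The conormal of `F_M` is `A dx₂ + B dρ²` with `B ≥ 0`.** [folklore] -/
theorem fderiv_FM_eq (hPd : Differentiable ℝ P) (hPd' : ∀ t, 0 ≤ deriv P t ∧ deriv P t ≤ 1)
    (hs : 0 < s) (x : EuclideanSpace ℝ (Fin 3)) :
    ∃ A B : ℝ, 0 ≤ B ∧ fderiv ℝ (FM P s) x =
      A • EuclideanSpace.proj (𝕜 := ℝ) (2 : Fin 3) + B • dhsq x := by
  obtain ⟨⟨h10, h11⟩, h20, h21⟩ := th_mem (s := s) hPd' x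
  refine ⟨_, _, ?_, (hasFDerivAt_FM hPd hs x).fderiv⟩
  exact mul_nonneg (by linarith) (by nlinarith)

/-- The radial pairings of the three arguments from `p₀`. [folklore] -/
theorem radial_pairings (x : EuclideanSpace ℝ (Fin 3)) :
    EuclideanSpace.proj (𝕜 := ℝ) (2 : Fin 3) (x - p0 s) = x 2 + s / 2 ∧
      dhsq x (x - p0 s) = 2 * hsq x := by
  constructor
  · simp
  · rw [dhsq_apply]; simp [hsq]; ring

/-- **Radial derivative of `F_M`** from `p₀`:
`DF_M(x)[x - p₀] = (1-θ₂)((1-θ₁)((x₂ + s/2) + 2sρ²) + 2θ₁ρ²) - θ₂(x₂ + s/2)`. [folklore] -/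
theorem fderiv_FM_apply_sub (hPd : Differentiable ℝ P) (hs : 0 < s) (x : EuclideanSpace ℝ (Fin 3)) :
    fderiv ℝ (FM P s) x (x - p0 s) =
      (1 - th2 P s x) * ((1 - th1 P s x) * ((x 2 + s / 2) + 2 * s * hsq x) + th1 P s x * (2 * hsq x))
        - th2 P s x * (x 2 + s / 2) := by
  rw [(hasFDerivAt_FM hPd hs x).fderiv]
  obtain ⟨e1, e2⟩ := radial_pairings (s := s) x
  simp only [_root_.add_apply, _root_.smul_apply, smul_eq_mul, e1, e2]
  ring

section Transversal

variable (hP0 : ∀ t, t ≤ -1 → P t = 0) (hP1 : ∀ t, 1 ≤ t → P t = t)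
  (hPd : Differentiable ℝ P) (hPd' : ∀ t, 0 ≤ deriv P t ∧ deriv P t ≤ 1)
  (hPge : ∀ t, max 0 t ≤ P t) (hPle : ∀ t, P t ≤ max 0 t + 1)
include hP0 hP1 hPd hPd' hPge hPle

/-- **Radial transversality**: at every zero `x` of `F_M`, `DF_M(x)[x - p₀] > 0` (`s ≤ 1/8`).
[cite: Schultens2014, proof of Thm. 3.2.5 (PDF p. 45)] -/
theorem fderiv_FM_apply_sub_pos (hs : 0 < s) (hs1 : s ≤ 1 / 8) {x : EuclideanSpace ℝ (Fin 3)}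
    (hx : FM P s x = 0) : 0 < fderiv ℝ (FM P s) x (x - p0 s) := by
  rw [fderiv_FM_apply_sub hPd hs]
  obtain ⟨⟨h10, h11⟩, h20, h21⟩ := th_mem (s := s) hPd' x
  have hκ : (0 : ℝ) < s / 8 := by positivity
  obtain ⟨hl1, hl2⟩ := lid'_bounds hPge hPle hs x (P := P)
  obtain ⟨hF1, hF2⟩ := FM_bounds hPge hPle hs x (P := P)
  have hh := hsq_nonneg x
  -- at a zero: `max(G', β) ∈ [-κ, 0]`
  have hm0 : max (lid' P s x) (bot s x) ≤ 0 := by linarith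
  have hmk : -(s / 8) ≤ max (lid' P s x) (bot s x) := by linarith
  have hlid0 : lid' P s x ≤ 0 := le_trans (le_max_left _ _) hm0
  have hbot0 : bot s x ≤ 0 := le_trans (le_max_right _ _) hm0
  have hbot_def : bot s x = -s - x 2 := rfl
  have htop_def : topFun s x = x 2 - s + s * hsq x := by unfold topFun; ring
  have hrim_def : rimFun' s x = hsq x - (1 + s) ^ 2 := rfl
  -- the arguments of `P'`
  have hθ2_zero : bot s x - lid' P s x ≤ -(s / 8) → th2 P s x = 0 := fun hle => by
    unfold th2
    exact SmoothMax.deriv_eq_zero_of_le hP0 hPge (by rw [div_le_iff₀ hκ]; linarith)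
  have hθ2_one : s / 8 ≤ bot s x - lid' P s x → th2 P s x = 1 := fun hle => by
    unfold th2
    exact SmoothMax.deriv_eq_one_of_le hPd hP1 hPge (by rw [le_div_iff₀ hκ]; linarith)
  have hθ1_one : s / 8 ≤ rimFun' s x - topFun s x → th1 P s x = 1 := fun hle => by
    unfold th1
    exact SmoothMax.deriv_eq_one_of_le hPd hP1 hPge (by rw [le_div_iff₀ hκ]; linarith)
  have hθ1_zero : rimFun' s x - topFun s x ≤ -(s / 8) → th1 P s x = 0 := fun hle => by
    unfold th1
    exact SmoothMax.deriv_eq_zero_of_le hP0 hPge (by rw [div_le_iff₀ hκ]; linarith)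
  -- a convex combination of two positive numbers is positive
  have hcomb : ∀ {θ L b : ℝ}, 0 ≤ θ → θ ≤ 1 → 0 < L → 0 < b → 0 < (1 - θ) * L + θ * b := by
    intro θ L b h0 h1 hL hb
    rcases le_or_gt L b with hLb | hLb
    · nlinarith [mul_nonneg h0 (sub_nonneg.2 hLb)]
    · nlinarith [mul_nonneg (sub_nonneg.2 h1) (sub_nonneg.2 hLb.le)]
  by_cases hA : bot s x - lid' P s x ≤ -(s / 8)
  · -- Case B: `θ₂ = 0`, so `F_M = G'` to first order
    have h2 : th2 P s x = 0 := hθ2_zero hA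
    rw [h2]
    simp only [sub_zero, one_mul, zero_mul]
    have hlidk : -(s / 8) ≤ lid' P s x := by
      have : max (lid' P s x) (bot s x) = lid' P s x := max_eq_left (by linarith)
      rw [this] at hmk; exact hmk
    by_cases hB : rimFun' s x - topFun s x ≤ -(s / 8)
    · -- top active: `θ₁ = 0`, `a ≥ -s/4`
      rw [hθ1_zero hB]
      simp only [sub_zero, one_mul, zero_mul, add_zero]
      have htopk : -(s / 4) ≤ topFun s x := by
        have : max (topFun s x) (rimFun' s x) = topFun s x := max_eq_left (by linarith)
        rw [this] at hl2; linarith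
      rw [htop_def] at htopk; nlinarith
    · -- rim nearly active: `b' ≥ -s/2`, so `ρ² > 1`; both pieces positive
      push Not at hB
      have hrimk : -(s / 2) ≤ rimFun' s x := by
        rcases le_or_gt (rimFun' s x) (topFun s x) with hc | hc
        · rw [max_eq_left hc] at hl2; linarith
        · rw [max_eq_right hc.le] at hl2; linarith
      have hhsq1 : 1 ≤ hsq x := by rw [hrim_def] at hrimk; nlinarith
      have hz : -s ≤ x 2 := by rw [hbot_def] at hbot0; linarith
      have hL1 : 0 < (x 2 + s / 2) + 2 * s * hsq x := by nlinarith
      have hL2 : 0 < 2 * hsq x := by linarith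
      exact hcomb h10 h11 hL1 hL2
  · -- Case A: `β > G' - κ`, so `z ≤ -3s/4` and the bottom term is `≥ s/4`
    push Not at hA
    have hz : x 2 ≤ -(3 * s / 4) := by
      rcases le_or_gt (bot s x) (lid' P s x) with hc | hc
      · rw [max_eq_left hc] at hmk; rw [hbot_def] at hA; linarith
      · rw [max_eq_right hc.le] at hmk; rw [hbot_def] at hmk; linarith
    have hz' : -s ≤ x 2 := by rw [hbot_def] at hbot0; linarith
    have hbterm : s / 4 ≤ -(x 2 + s / 2) := by linarith
    by_cases hC : hsq x < 1 / 2
    · -- near the axis: the lid is far below, `θ₂ = 1`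
      have htop_small : topFun s x ≤ -(5 * s / 4) := by rw [htop_def]; nlinarith
      have hrim_small : rimFun' s x ≤ -(5 * s / 4) := by rw [hrim_def]; nlinarith
      have hlid_small : lid' P s x ≤ -(9 * s / 8) := by
        have := max_le htop_small hrim_small; linarith
      have hbotk : -(s / 8) ≤ bot s x := by
        rcases le_or_gt (bot s x) (lid' P s x) with hc | hc
        · rw [max_eq_left hc] at hmk; linarith
        · rw [max_eq_right hc.le] at hmk; exact hmk
      rw [hθ2_one (by linarith)]
      simp only [sub_self, zero_mul, one_mul, zero_sub]
      linarith
    · -- away from the axis: both pieces of the lid term are positive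
      push Not at hC
      have hL1 : 0 < (x 2 + s / 2) + 2 * s * hsq x := by nlinarith
      have hL2 : 0 < 2 * hsq x := by linarith
      have hL : 0 < (1 - th1 P s x) * ((x 2 + s / 2) + 2 * s * hsq x) + th1 P s x * (2 * hsq x) :=
        hcomb h10 h11 hL1 hL2
      have hb : 0 < -(x 2 + s / 2) := by linarith
      have := hcomb h20 h21 hL hb
      linarith

end Transversal

/-! ### §3 The radial function of `∂M` about `p₀` -/

/-- From a positive derivative at a zero: positive just to the right. [folklore] -/
theorem eventually_pos_right {g : ℝ → ℝ} {d a : ℝ} (hg : HasDerivAt g d a) (h0 : g a = 0)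
    (hd : 0 < d) : ∀ᶠ t in 𝓝[>] a, 0 < g t := by
  have ht := hg.tendsto_slope
  have hev : ∀ᶠ t in 𝓝[≠] a, 0 < slope g a t := ht (Ioi_mem_nhds hd)
  have hev' : ∀ᶠ t in 𝓝[>] a, 0 < slope g a t :=
    hev.filter_mono (nhdsWithin_mono _ fun t ht => ne_of_gt ht)
  filter_upwards [hev', self_mem_nhdsWithin] with t hs ht
  rw [slope_def_field, h0, sub_zero] at hs
  exact (div_pos_iff.1 hs).elim (fun h => h.1) fun h => absurd h.2 (not_lt.2 (sub_pos.2 (mem_Ioi.1 ht)).le)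

/-- From a positive derivative at a zero: negative just to the left. [folklore] -/
theorem eventually_neg_left {g : ℝ → ℝ} {d a : ℝ} (hg : HasDerivAt g d a) (h0 : g a = 0)
    (hd : 0 < d) : ∀ᶠ t in 𝓝[<] a, g t < 0 := by
  have ht := hg.tendsto_slope
  have hev : ∀ᶠ t in 𝓝[≠] a, 0 < slope g a t := ht (Ioi_mem_nhds hd)
  have hev' : ∀ᶠ t in 𝓝[<] a, 0 < slope g a t :=
    hev.filter_mono (nhdsWithin_mono _ fun t ht => ne_of_lt ht)
  filter_upwards [hev', self_mem_nhdsWithin] with t hs ht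
  rw [slope_def_field, h0, sub_zero] at hs
  have hneg : t - a < 0 := sub_neg.2 (mem_Iio.1 ht)
  rcases div_pos_iff.1 hs with h | h
  · exact absurd h.2 (not_lt.2 hneg.le)
  · exact h.1

/-- **A continuous function all of whose zeros are transversal upward crossings has at most one
zero on an interval.** [folklore] -/
theorem no_two_zeros {g : ℝ → ℝ} {a b : ℝ} (hab : a < b) (hg : ContinuousOn g (Icc a b))
    (ha : g a = 0) (hb : g b = 0)
    (hpos : ∀ t ∈ Icc a b, g t = 0 → ∃ d, HasDerivAt g d t ∧ 0 < d) : False := by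
  -- `g > 0` just after `a`
  obtain ⟨da, hda, hda0⟩ := hpos a (left_mem_Icc.2 hab.le) ha
  obtain ⟨u, hu, hup⟩ := (mem_nhdsGT_iff_exists_Ioo_subset' hab).1 (eventually_pos_right hda ha hda0)
  have hu' : a < u := hu
  -- so for `a' = min ((a+u)/2) ((a+b)/2)`, `g a' > 0`
  set a' : ℝ := min ((a + u) / 2) ((a + b) / 2) with ha'
  have haa' : a < a' := lt_min (by linarith) (by linarith)
  have ha'b : a' < b := lt_of_le_of_lt (min_le_right _ _) (by linarith)
  have hga' : 0 < g a' := hup ⟨haa', lt_of_le_of_lt (min_le_left _ _) (by linarith)⟩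
  -- the first point of `[a', b]` where `g ≤ 0`
  set S : Set ℝ := Icc a' b ∩ {t | g t ≤ 0} with hS
  have hSne : S.Nonempty := ⟨b, ⟨right_mem_Icc.2 ha'b.le, by simp [hb]⟩⟩
  have hIcc : Icc a' b ⊆ Icc a b := Icc_subset_Icc haa'.le le_rfl
  have hSc : IsClosed S :=
    (hg.mono hIcc).preimage_isClosed_of_isClosed isClosed_Icc isClosed_Iic
  have hbdd : BddBelow S := ⟨a', fun t ht => ht.1.1⟩
  set c := sInf S with hc
  have hcS : c ∈ S := hSc.csInf_mem hSne hbdd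
  obtain ⟨⟨hca', hcb⟩, hgc⟩ := hcS
  have hgc : g c ≤ 0 := hgc
  -- before `c` (and after `a'`), `g > 0`
  have hbefore : ∀ t, a' ≤ t → t < c → 0 < g t := by
    intro t h1 h2
    by_contra hle; push Not at hle
    have : t ∈ S := ⟨⟨h1, le_trans h2.le hcb⟩, hle⟩
    exact absurd (csInf_le hbdd this) (not_le.2 h2)
  have hca'' : a' < c := by
    rcases hca'.lt_or_eq with h | h
    · exact h
    · exfalso; rw [← h] at hgc; linarith
  -- `g c = 0`: `g c ≤ 0`, and `g c ≥ 0` by continuity from the left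
  have hgc0 : g c = 0 := by
    refine le_antisymm hgc ?_
    by_contra hlt; push Not at hlt
    have hcont : ContinuousWithinAt g (Icc a b) c := hg c (hIcc ⟨hca', hcb⟩)
    have hev : ∀ᶠ t in 𝓝[Icc a b] c, g t < 0 := hcont.eventually (gt_mem_nhds hlt)
    -- points of `[a', c)` close to `c` are in `Icc a b`
    have hev' : ∀ᶠ t in 𝓝[<] c, g t < 0 := by
      have hsub : 𝓝[Ioo a' c] c ≤ 𝓝[Icc a b] c :=
        nhdsWithin_mono _ fun t ht => hIcc ⟨ht.1.le, le_trans ht.2.le hcb⟩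
      have h1 : ∀ᶠ t in 𝓝[Ioo a' c] c, g t < 0 := hev.filter_mono hsub
      rw [← nhdsWithin_Ioo_eq_nhdsLT hca''] ; exact h1
    obtain ⟨l, hl, hlp⟩ := (mem_nhdsLT_iff_exists_Ioo_subset' hca'').1 hev'
    have hl' : l < c := hl
    set t₀ : ℝ := max ((l + c) / 2) ((a' + c) / 2) with ht₀
    have h1 : t₀ < c := max_lt (by linarith [hl']) (by linarith)
    have h2 : a' ≤ t₀ := le_trans (by linarith) (le_max_right _ _)
    have h3 : l < t₀ := lt_of_lt_of_le (by linarith [hl']) (le_max_left _ _)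
    have hn : g t₀ < 0 := hlp ⟨h3, h1⟩
    have := hbefore t₀ h2 h1
    linarith
  -- the derivative at `c` is positive, so `g < 0` just before `c`: contradiction
  obtain ⟨dc, hdc, hdc0⟩ := hpos c (hIcc ⟨hca', hcb⟩) hgc0
  obtain ⟨l, hl, hlp⟩ := (mem_nhdsLT_iff_exists_Ioo_subset' hca'').1 (eventually_neg_left hdc hgc0 hdc0)
  have hl' : l < c := hl
  set t₀ : ℝ := max ((l + c) / 2) ((a' + c) / 2) with ht₀
  have h1 : t₀ < c := max_lt (by linarith [hl']) (by linarith)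
  have h2 : a' ≤ t₀ := le_trans (by linarith) (le_max_right _ _)
  have h3 : l < t₀ := lt_of_lt_of_le (by linarith [hl']) (le_max_left _ _)
  have hn : g t₀ < 0 := hlp ⟨h3, h1⟩
  have := hbefore t₀ h2 h1
  linarith

section Root

variable (hP : ContDiff ℝ ∞ P) (hP0 : ∀ t, t ≤ -1 → P t = 0) (hP1 : ∀ t, 1 ≤ t → P t = t)
  (hPd' : ∀ t, 0 ≤ deriv P t ∧ deriv P t ≤ 1)
  (hPge : ∀ t, max 0 t ≤ P t) (hPle : ∀ t, P t ≤ max 0 t + 1) (hs : 0 < s) (hs1 : s ≤ 1 / 8)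
include hP hP0 hP1 hPd' hPge hPle hs hs1

omit hP0 hP1 hPd' hPge hPle hs hs1 in
/-- The ray function `t ↦ F_M(p₀ + t y)` and its derivative. [folklore] -/
theorem hasDerivAt_ray (y : EuclideanSpace ℝ (Fin 3)) (t : ℝ) :
    HasDerivAt (fun τ : ℝ => FM P s (p0 s + τ • y)) (fderiv ℝ (FM P s) (p0 s + t • y) y) t := by
  have hd : HasFDerivAt (FM P s) (fderiv ℝ (FM P s) (p0 s + t • y)) (p0 s + t • y) :=
    ((contDiff_FM hP).differentiable (by simp) _).hasFDerivAt
  have hl : HasDerivAt (fun τ : ℝ => p0 s + τ • y) y t := by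
    simpa using ((hasDerivAt_id t).smul_const y).const_add (p0 s)
  exact hd.comp_hasDerivAt t hl

/-- At a zero on a ray (`t > 0`) the ray derivative is positive. [folklore] -/
theorem ray_deriv_pos {y : EuclideanSpace ℝ (Fin 3)} {t : ℝ} (ht : 0 < t)
    (h0 : FM P s (p0 s + t • y) = 0) : 0 < fderiv ℝ (FM P s) (p0 s + t • y) y := by
  have hPd : Differentiable ℝ P := hP.differentiable (by simp)
  have h := fderiv_FM_apply_sub_pos hP0 hP1 hPd hPd' hPge hPle hs hs1 h0
  have he : p0 s + t • y - p0 s = t • y := by abel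
  rw [he, map_smul, smul_eq_mul] at h
  exact pos_of_mul_pos_right h ht.le

omit hP0 hP1 hPd' in
/-- **Existence of a root** on every ray: for `y ≠ 0` there is `t ∈ (0, 3/‖y‖]` with
`F_M(p₀ + t y) = 0`. [folklore] -/
theorem exists_root {y : EuclideanSpace ℝ (Fin 3)} (hy : y ≠ 0) :
    ∃ t : ℝ, 0 < t ∧ t ≤ 3 / ‖y‖ ∧ FM P s (p0 s + t • y) = 0 := by
  have hny : 0 < ‖y‖ := norm_pos_iff.2 hy
  set T : ℝ := 3 / ‖y‖ with hT
  have hT0 : 0 < T := by positivity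
  have hcont : ContinuousOn (fun τ : ℝ => FM P s (p0 s + τ • y)) (Icc 0 T) :=
    ((contDiff_FM hP).continuous.comp (by fun_prop)).continuousOn
  have h0 : FM P s (p0 s + (0:ℝ) • y) < 0 := by
    rw [zero_smul, add_zero]; exact FM_p0_neg hPge hPle hs hs1
  have h1 : 0 < FM P s (p0 s + T • y) := by
    have hu : ‖‖y‖⁻¹ • y‖ = 1 := norm_smul_inv_norm (𝕜 := ℝ) hy
    have : T • y = (3 : ℝ) • (‖y‖⁻¹ • y) := by
      rw [smul_smul, hT, div_eq_mul_inv]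
    rw [this]
    exact FM_pos_of_far hPge hPle hs hs1 hu le_rfl
  obtain ⟨t, ht, hgt⟩ := intermediate_value_Icc hT0.le hcont ⟨h0.le, h1.le⟩
  have hgt' : FM P s (p0 s + t • y) = 0 := hgt
  have ht0 : t ≠ 0 := by rintro rfl; linarith
  exact ⟨t, lt_of_le_of_ne ht.1 (Ne.symm ht0), ht.2, hgt'⟩

/-- **Uniqueness of the root** on each ray among `t > 0`. [folklore] -/
theorem root_unique {y : EuclideanSpace ℝ (Fin 3)} {t₁ t₂ : ℝ} (h₁ : 0 < t₁) (h₂ : 0 < t₂)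
    (hz₁ : FM P s (p0 s + t₁ • y) = 0) (hz₂ : FM P s (p0 s + t₂ • y) = 0) : t₁ = t₂ := by
  by_contra hne
  have hcont : Continuous (fun τ : ℝ => FM P s (p0 s + τ • y)) :=
    (contDiff_FM hP).continuous.comp (by fun_prop)
  have hposd : ∀ (c : ℝ), ∀ t ∈ Icc (min t₁ t₂) (max t₁ t₂), FM P s (p0 s + t • y) = 0 →
      ∃ d, HasDerivAt (fun τ : ℝ => FM P s (p0 s + τ • y)) d t ∧ 0 < d := by
    intro _ t ht h0
    have htpos : 0 < t := lt_of_lt_of_le (lt_min h₁ h₂) ht.1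
    exact ⟨_, hasDerivAt_ray hP y t,
      ray_deriv_pos hP hP0 hP1 hPd' hPge hPle hs hs1 htpos h0⟩
  rcases lt_or_gt_of_ne hne with hlt | hlt
  · exact no_two_zeros hlt hcont.continuousOn hz₁ hz₂
      (by simpa [min_eq_left hlt.le, max_eq_right hlt.le] using hposd 0)
  · exact no_two_zeros hlt hcont.continuousOn hz₂ hz₁
      (by simpa [min_eq_right hlt.le, max_eq_left hlt.le] using hposd 0)

end Root

open Classical in
/-- **The root function** `t*(y)`: the unique `t > 0` with `F_M(p₀ + t y) = 0` (for `y ≠ 0`;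
junk value `1` at `y = 0`). [folklore] -/
def rootFn (P : ℝ → ℝ) (s : ℝ) (y : EuclideanSpace ℝ (Fin 3)) : ℝ :=
  if h : ∃ t : ℝ, 0 < t ∧ FM P s (p0 s + t • y) = 0 then Classical.choose h else 1

section RootFn

variable (hP : ContDiff ℝ ∞ P) (hP0 : ∀ t, t ≤ -1 → P t = 0) (hP1 : ∀ t, 1 ≤ t → P t = t)
  (hPd' : ∀ t, 0 ≤ deriv P t ∧ deriv P t ≤ 1)
  (hPge : ∀ t, max 0 t ≤ P t) (hPle : ∀ t, P t ≤ max 0 t + 1) (hs : 0 < s) (hs1 : s ≤ 1 / 8)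
include hP hP0 hP1 hPd' hPge hPle hs hs1

/-- Specification of the root function. [folklore] -/
theorem rootFn_spec {y : EuclideanSpace ℝ (Fin 3)} (hy : y ≠ 0) :
    0 < rootFn P s y ∧ rootFn P s y ≤ 3 / ‖y‖ ∧ FM P s (p0 s + rootFn P s y • y) = 0 := by
  obtain ⟨t, ht, htT, hzt⟩ := exists_root hP hPge hPle hs hs1 hy
  have hex : ∃ t : ℝ, 0 < t ∧ FM P s (p0 s + t • y) = 0 := ⟨t, ht, hzt⟩
  have hch := Classical.choose_spec hex
  have hdef : rootFn P s y = Classical.choose hex := by unfold rootFn; rw [dif_pos hex]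
  rw [hdef]
  have heq : Classical.choose hex = t :=
    root_unique hP hP0 hP1 hPd' hPge hPle hs hs1 hch.1 ht hch.2 hzt
  refine ⟨hch.1, ?_, hch.2⟩
  rw [heq]; exact htT

/-- Any positive root is the root function. [folklore] -/
theorem eq_rootFn {y : EuclideanSpace ℝ (Fin 3)} (hy : y ≠ 0) {t : ℝ} (ht : 0 < t)
    (hz : FM P s (p0 s + t • y) = 0) : t = rootFn P s y := by
  obtain ⟨h1, -, h3⟩ := rootFn_spec hP hP0 hP1 hPd' hPge hPle hs hs1 hy
  exact root_unique hP hP0 hP1 hPd' hPge hPle hs hs1 ht h1 hz h3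

/-- **Homogeneity**: `t*(λ y) = t*(y)/λ` for `λ > 0`. [folklore] -/
theorem rootFn_smul {y : EuclideanSpace ℝ (Fin 3)} (hy : y ≠ 0) {lam : ℝ} (hlam : 0 < lam) :
    rootFn P s (lam • y) = rootFn P s y / lam := by
  obtain ⟨h1, -, h3⟩ := rootFn_spec hP hP0 hP1 hPd' hPge hPle hs hs1 hy
  have hy' : lam • y ≠ 0 := smul_ne_zero hlam.ne' hy
  symm
  apply eq_rootFn hP hP0 hP1 hPd' hPge hPle hs hs1 hy' (div_pos h1 hlam)
  rw [smul_smul, div_mul_cancel₀ _ hlam.ne']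
  exact h3

/-- **Sign along the ray**: negative before the root. [folklore] -/
theorem FM_ray_neg {y : EuclideanSpace ℝ (Fin 3)} (hy : y ≠ 0) {t : ℝ} (ht0 : 0 ≤ t)
    (ht : t < rootFn P s y) : FM P s (p0 s + t • y) < 0 := by
  by_contra hge; push Not at hge
  have hcont : ContinuousOn (fun τ : ℝ => FM P s (p0 s + τ • y)) (Icc 0 t) :=
    ((contDiff_FM hP).continuous.comp (by fun_prop)).continuousOn
  have h0 : FM P s (p0 s + (0:ℝ) • y) < 0 := by
    rw [zero_smul, add_zero]; exact FM_p0_neg hPge hPle hs hs1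
  obtain ⟨τ, hτ, hzτ⟩ := intermediate_value_Icc ht0 hcont ⟨h0.le, hge⟩
  have hzτ' : FM P s (p0 s + τ • y) = 0 := hzτ
  have hτ0 : τ ≠ 0 := by rintro rfl; linarith
  have := eq_rootFn hP hP0 hP1 hPd' hPge hPle hs hs1 hy (lt_of_le_of_ne hτ.1 (Ne.symm hτ0)) hzτ'
  linarith [hτ.2]

/-- **Sign along the ray**: positive after the root. [folklore] -/
theorem FM_ray_pos {y : EuclideanSpace ℝ (Fin 3)} (hy : y ≠ 0) {t : ℝ} (ht : rootFn P s y < t) :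
    0 < FM P s (p0 s + t • y) := by
  obtain ⟨h1, h2, h3⟩ := rootFn_spec hP hP0 hP1 hPd' hPge hPle hs hs1 hy
  by_contra hle; push Not at hle
  have hny : 0 < ‖y‖ := norm_pos_iff.2 hy
  -- a far point `T ≥ t` with positive value
  set T : ℝ := max t (3 / ‖y‖) with hT
  have hTpos : 0 < FM P s (p0 s + T • y) := by
    have hu : ‖‖y‖⁻¹ • y‖ = 1 := norm_smul_inv_norm (𝕜 := ℝ) hy
    have : T • y = (T * ‖y‖) • (‖y‖⁻¹ • y) := by
      rw [smul_smul, mul_assoc, mul_inv_cancel₀ hny.ne', mul_one]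
    rw [this]
    refine FM_pos_of_far hPge hPle hs hs1 hu ?_
    have : 3 / ‖y‖ * ‖y‖ = 3 := div_mul_cancel₀ _ hny.ne'
    nlinarith [le_max_right t (3 / ‖y‖)]
  have htT : t ≤ T := le_max_left _ _
  have hcont : ContinuousOn (fun τ : ℝ => FM P s (p0 s + τ • y)) (Icc t T) :=
    ((contDiff_FM hP).continuous.comp (by fun_prop)).continuousOn
  obtain ⟨τ, hτ, hzτ⟩ := intermediate_value_Icc htT hcont ⟨hle, hTpos.le⟩
  have := eq_rootFn hP hP0 hP1 hPd' hPge hPle hs hs1 hy (by linarith [hτ.1]) hzτ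
  linarith [hτ.1]

/-- **The root function is smooth** off the origin (implicit function theorem, via the local
inverse of `(t, y) ↦ (F_M(p₀ + t y), y)`). [folklore] -/
theorem contDiffAt_rootFn {y : EuclideanSpace ℝ (Fin 3)} (hy : y ≠ 0) :
    ContDiffAt ℝ ∞ (rootFn P s) y := by
  obtain ⟨ht, -, hz⟩ := rootFn_spec hP hP0 hP1 hPd' hPge hPle hs hs1 hy
  set t₀ := rootFn P s y with ht₀_def
  set x₀ := p0 s + t₀ • y with hx₀
  -- the map `f (t, v) = (F_M(p₀ + t v), v)` and its derivative at `(t₀, y)`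
  set f : ℝ × EuclideanSpace ℝ (Fin 3) → ℝ × EuclideanSpace ℝ (Fin 3) :=
    fun q => (FM P s (p0 s + q.1 • q.2), q.2) with hf
  have hfs : ContDiff ℝ ∞ f :=
    ((contDiff_FM hP).comp (contDiff_const.add (contDiff_fst.smul contDiff_snd))).prodMk contDiff_snd
  set D : EuclideanSpace ℝ (Fin 3) →L[ℝ] ℝ := fderiv ℝ (FM P s) x₀ with hD
  set α : ℝ := D y with hα
  have hαpos : 0 < α := ray_deriv_pos hP hP0 hP1 hPd' hPge hPle hs hs1 ht hz
  set φ : EuclideanSpace ℝ (Fin 3) →L[ℝ] ℝ := t₀ • D with hφ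
  -- the derivative as an equivalence
  set L : (ℝ × EuclideanSpace ℝ (Fin 3)) →L[ℝ] (ℝ × EuclideanSpace ℝ (Fin 3)) :=
    ((α • ContinuousLinearMap.fst ℝ ℝ (EuclideanSpace ℝ (Fin 3))) +
      φ.comp (ContinuousLinearMap.snd ℝ ℝ (EuclideanSpace ℝ (Fin 3)))).prod
      (ContinuousLinearMap.snd ℝ ℝ (EuclideanSpace ℝ (Fin 3))) with hL
  set Linv : (ℝ × EuclideanSpace ℝ (Fin 3)) →L[ℝ] (ℝ × EuclideanSpace ℝ (Fin 3)) :=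
    ((α⁻¹ • ContinuousLinearMap.fst ℝ ℝ (EuclideanSpace ℝ (Fin 3))) -
      (α⁻¹ • φ).comp (ContinuousLinearMap.snd ℝ ℝ (EuclideanSpace ℝ (Fin 3)))).prod
      (ContinuousLinearMap.snd ℝ ℝ (EuclideanSpace ℝ (Fin 3))) with hLinv
  have h1 : ∀ q, Linv (L q) = q := by
    intro q
    obtain ⟨a, v⟩ := q
    refine Prod.ext ?_ rfl
    simp only [hL, hLinv, ContinuousLinearMap.prod_apply, _root_.add_apply, _root_.sub_apply,
      _root_.smul_apply, ContinuousLinearMap.coe_fst', ContinuousLinearMap.coe_snd',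
      ContinuousLinearMap.coe_comp, Function.comp_apply, smul_eq_mul]
    field_simp
    ring
  have h2 : ∀ q, L (Linv q) = q := by
    intro q
    obtain ⟨b, v⟩ := q
    refine Prod.ext ?_ rfl
    simp only [hL, hLinv, ContinuousLinearMap.prod_apply, _root_.add_apply, _root_.sub_apply,
      _root_.smul_apply, ContinuousLinearMap.coe_fst', ContinuousLinearMap.coe_snd',
      ContinuousLinearMap.coe_comp, Function.comp_apply, smul_eq_mul]
    field_simp
    ring
  set Le : (ℝ × EuclideanSpace ℝ (Fin 3)) ≃L[ℝ] (ℝ × EuclideanSpace ℝ (Fin 3)) :=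
    ContinuousLinearEquiv.equivOfInverse L Linv h1 h2 with hLe
  -- `f` has derivative `L` at `(t₀, y)`
  have hfd : HasFDerivAt f (Le : (ℝ × EuclideanSpace ℝ (Fin 3)) →L[ℝ] (ℝ × EuclideanSpace ℝ (Fin 3)))
      (t₀, y) := by
    have hin : HasFDerivAt (fun q : ℝ × EuclideanSpace ℝ (Fin 3) => p0 s + q.1 • q.2)
        ((t₀, y).1 • ContinuousLinearMap.snd ℝ ℝ (EuclideanSpace ℝ (Fin 3)) +
          (ContinuousLinearMap.fst ℝ ℝ (EuclideanSpace ℝ (Fin 3))).smulRight (t₀, y).2) (t₀, y) :=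
      ((hasFDerivAt_fst (p := (t₀, y))).fun_smul (hasFDerivAt_snd (p := (t₀, y)))).const_add (p0 s)
    have hF : HasFDerivAt (FM P s) D (p0 s + (t₀, y).1 • (t₀, y).2) :=
      ((contDiff_FM hP).differentiable (by simp) _).hasFDerivAt
    have hcomp := (hF.comp (t₀, y) hin).prodMk (hasFDerivAt_snd (𝕜 := ℝ) (p := (t₀, y)))
    refine hcomp.congr_fderiv ?_
    refine ContinuousLinearMap.ext fun q => ?_
    obtain ⟨a, v⟩ := q
    refine Prod.ext ?_ rfl
    simp only [hLe, ContinuousLinearEquiv.coe_coe, ContinuousLinearEquiv.equivOfInverse_apply, hL, ContinuousLinearMap.prod_apply,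
      ContinuousLinearMap.coe_comp, Function.comp_apply, _root_.add_apply, _root_.smul_apply,
      ContinuousLinearMap.coe_snd', ContinuousLinearMap.smulRight_apply, ContinuousLinearMap.coe_fst',
      hφ, hα, map_add, map_smul, smul_eq_mul]
    ring
  have hfa : ContDiffAt ℝ ∞ f (t₀, y) := hfs.contDiffAt
  have hstrict := hfa.hasStrictFDerivAt' hfd (by simp)
  set Ψ := hstrict.localInverse f Le (t₀, y) with hΨ
  have hΨs : ContDiffAt ℝ ∞ Ψ (f (t₀, y)) := hfa.to_localInverse hfd (by simp)
  have hfa0 : f (t₀, y) = (0, y) := Prod.ext hz rfl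
  have hright : ∀ᶠ q in 𝓝 ((0 : ℝ), y), f (Ψ q) = q := by
    rw [← hfa0]; exact hstrict.eventually_right_inverse
  have hΨcont : ContinuousAt Ψ ((0 : ℝ), y) := by rw [← hfa0]; exact hΨs.continuousAt
  have hΨ0 : Ψ ((0 : ℝ), y) = (t₀, y) := by rw [← hfa0]; exact hstrict.localInverse_apply_image
  -- near `y`, `rootFn v = (Ψ (0, v)).1`
  have hcurve : Continuous fun v : EuclideanSpace ℝ (Fin 3) => ((0 : ℝ), v) := by fun_prop
  have hev1 : ∀ᶠ v in 𝓝 y, f (Ψ ((0 : ℝ), v)) = ((0 : ℝ), v) :=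
    hcurve.continuousAt.eventually hright
  have hev2 : ∀ᶠ v in 𝓝 y, 0 < (Ψ ((0 : ℝ), v)).1 := by
    have hc : ContinuousAt (fun v : EuclideanSpace ℝ (Fin 3) => (Ψ ((0 : ℝ), v)).1) y :=
      continuousAt_fst.comp (hΨcont.comp_of_eq hcurve.continuousAt rfl)
    have : 0 < (Ψ ((0 : ℝ), y)).1 := by rw [hΨ0]; exact ht
    exact hc.eventually (lt_mem_nhds this)
  have hev3 : ∀ᶠ v in 𝓝 y, v ≠ 0 := isOpen_ne.mem_nhds hy
  have heq : rootFn P s =ᶠ[𝓝 y] fun v => (Ψ ((0 : ℝ), v)).1 := by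
    filter_upwards [hev1, hev2, hev3] with v h1v h2v h3v
    -- `f (Ψ (0, v)) = (0, v)`: second component says `(Ψ (0,v)).2 = v`, first: a root
    have hsnd : (Ψ ((0 : ℝ), v)).2 = v := by
      have := congrArg Prod.snd h1v; simpa [hf] using this
    have hfst : FM P s (p0 s + (Ψ ((0 : ℝ), v)).1 • v) = 0 := by
      have := congrArg Prod.fst h1v; simpa [hf, hsnd] using this
    exact (eq_rootFn hP hP0 hP1 hPd' hPge hPle hs hs1 h3v h2v hfst).symm
  refine ContDiffAt.congr_of_eventuallyEq ?_ heq
  have hin0 : ContDiffAt ℝ ∞ (fun v : EuclideanSpace ℝ (Fin 3) => ((0 : ℝ), v)) y :=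
    contDiffAt_const.prodMk contDiffAt_id
  have hΨs' : ContDiffAt ℝ ∞ Ψ ((0 : ℝ), y) := hfa0 ▸ hΨs
  exact contDiffAt_fst.comp y (ContDiffAt.comp y hΨs' hin0)

end RootFn

/-! ### §4 The direction profile, the model diffeomorphism, agreement with the lid -/

open Classical in
/-- **The direction profile** `c(y) = t*(y) ‖y‖` (`c(0) = s/8`). [folklore] -/
def prof (P : ℝ → ℝ) (s : ℝ) (y : EuclideanSpace ℝ (Fin 3)) : ℝ :=
  if y = 0 then s / 8 else rootFn P s y * ‖y‖

/-- `c(y) = t*(y) ‖y‖` for `y ≠ 0`. [folklore] -/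
theorem prof_of_ne {y : EuclideanSpace ℝ (Fin 3)} (hy : y ≠ 0) : prof P s y = rootFn P s y * ‖y‖ := by
  unfold prof; rw [if_neg hy]

/-- `c(0) = s/8`. [folklore] -/
theorem prof_zero : prof P s 0 = s / 8 := by unfold prof; rw [if_pos rfl]

section Profile

variable (hP : ContDiff ℝ ∞ P) (hP0 : ∀ t, t ≤ -1 → P t = 0) (hP1 : ∀ t, 1 ≤ t → P t = t)
  (hPd' : ∀ t, 0 ≤ deriv P t ∧ deriv P t ≤ 1)
  (hPge : ∀ t, max 0 t ≤ P t) (hPle : ∀ t, P t ≤ max 0 t + 1) (hs : 0 < s) (hs1 : s ≤ 1 / 8)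
include hP hP0 hP1 hPd' hPge hPle hs hs1

/-- `c ≥ s/8`. [folklore] -/
theorem le_prof (y : EuclideanSpace ℝ (Fin 3)) : s / 8 ≤ prof P s y := by
  by_cases hy : y = 0
  · rw [hy, prof_zero]
  · rw [prof_of_ne hy]
    obtain ⟨h1, -, h3⟩ := rootFn_spec hP hP0 hP1 hPd' hPge hPle hs hs1 hy
    by_contra hlt; push Not at hlt
    have hnear : ‖p0 s + rootFn P s y • y - p0 s‖ ≤ s / 8 := by
      rw [add_sub_cancel_left, norm_smul, Real.norm_eq_abs, abs_of_pos h1]; exact hlt.le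
    have := FM_le_of_near hPge hPle hs hs1 hnear (P := P)
    linarith

/-- `c` is constant along open rays. [folklore] -/
theorem prof_smul (y : EuclideanSpace ℝ (Fin 3)) {t : ℝ} (ht : 0 < t) : prof P s (t • y) = prof P s y := by
  by_cases hy : y = 0
  · rw [hy, smul_zero]
  · rw [prof_of_ne hy, prof_of_ne (smul_ne_zero ht.ne' hy), rootFn_smul hP hP0 hP1 hPd' hPge hPle hs hs1 hy ht,
      norm_smul, Real.norm_eq_abs, abs_of_pos ht]
    field_simp

/-- `c` is smooth off the origin. [folklore] -/
theorem contDiffAt_prof {y : EuclideanSpace ℝ (Fin 3)} (hy : y ≠ 0) : ContDiffAt ℝ ∞ (prof P s) y := by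
  have hev : prof P s =ᶠ[𝓝 y] fun v => rootFn P s v * ‖v‖ := by
    filter_upwards [isOpen_ne.mem_nhds hy] with v hv
    exact prof_of_ne hv
  refine ContDiffAt.congr_of_eventuallyEq ?_ hev
  exact (contDiffAt_rootFn hP hP0 hP1 hPd' hPge hPle hs hs1 hy).mul (contDiffAt_norm ℝ hy)

/-- **`c` is a direction profile** in the sense of `RadialBallMap`. [folklore] -/
theorem isProfile : RadialBallMap.IsProfile (prof P s) (s / 8) where
  pos := by positivity
  lower := le_prof hP hP0 hP1 hPd' hPge hPle hs hs1
  ray y t ht := prof_smul hP hP0 hP1 hPd' hPge hPle hs hs1 y ht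
  smooth _ hy := contDiffAt_prof hP hP0 hP1 hPd' hPge hPle hs hs1 hy

/-- **The model solid is star-shaped with radial function `c`**:
`{F_M ≤ 0} = {‖x - p₀‖ ≤ c(x - p₀)}`, and similarly for `= 0` and `< 0`. [folklore] -/
theorem setOf_FM_cmp :
    {x | FM P s x ≤ 0} = {x | ‖x - p0 s‖ ≤ prof P s (x - p0 s)} ∧
    {x | FM P s x = 0} = {x | ‖x - p0 s‖ = prof P s (x - p0 s)} ∧
    {x | FM P s x < 0} = {x | ‖x - p0 s‖ < prof P s (x - p0 s)} := by
  have hp0 := FM_p0_neg hPge hPle hs hs1 (P := P)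
  -- pointwise trichotomy off the centre
  have key : ∀ x, x ≠ p0 s →
      ((FM P s x ≤ 0 ↔ ‖x - p0 s‖ ≤ prof P s (x - p0 s)) ∧
       (FM P s x = 0 ↔ ‖x - p0 s‖ = prof P s (x - p0 s)) ∧
       (FM P s x < 0 ↔ ‖x - p0 s‖ < prof P s (x - p0 s))) := by
    intro x hx
    set v := x - p0 s with hv
    have hv0 : v ≠ 0 := sub_ne_zero.2 hx
    have hnv : 0 < ‖v‖ := norm_pos_iff.2 hv0
    have hxv : x = p0 s + (1 : ℝ) • v := by rw [one_smul, hv]; abel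
    obtain ⟨h1, -, h3⟩ := rootFn_spec hP hP0 hP1 hPd' hPge hPle hs hs1 hv0
    rw [prof_of_ne hv0]
    have e1 : ‖v‖ ≤ rootFn P s v * ‖v‖ ↔ 1 ≤ rootFn P s v := by
      constructor
      · intro h; nlinarith
      · intro h; nlinarith
    have e2 : ‖v‖ = rootFn P s v * ‖v‖ ↔ 1 = rootFn P s v := by
      constructor
      · intro h; field_simp at h; linarith
      · intro h; rw [← h, one_mul]
    have e3 : ‖v‖ < rootFn P s v * ‖v‖ ↔ 1 < rootFn P s v := by
      constructor
      · intro h; nlinarith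
      · intro h; nlinarith
    rw [e1, e2, e3]
    -- trichotomy of `1` against the root
    rcases lt_trichotomy 1 (rootFn P s v) with hlt | heq | hgt
    · have hneg : FM P s x < 0 := by
        rw [hxv]; exact FM_ray_neg hP hP0 hP1 hPd' hPge hPle hs hs1 hv0 zero_le_one hlt
      exact ⟨⟨fun _ => hlt.le, fun _ => hneg.le⟩, ⟨fun h => absurd h hneg.ne, fun h => absurd h hlt.ne⟩,
        ⟨fun _ => hlt, fun _ => hneg⟩⟩
    · have hzero : FM P s x = 0 := by rw [hxv, heq]; exact h3
      exact ⟨⟨fun _ => heq.le, fun _ => hzero.le⟩, ⟨fun _ => heq, fun _ => hzero⟩,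
        ⟨fun h => absurd hzero h.ne, fun h => absurd heq.symm h.ne'⟩⟩
    · have hpos : 0 < FM P s x := by
        rw [hxv]; exact FM_ray_pos hP hP0 hP1 hPd' hPge hPle hs hs1 hv0 hgt
      exact ⟨⟨fun h => absurd h (not_le.2 hpos), fun h => absurd h (not_le.2 hgt)⟩,
        ⟨fun h => absurd h hpos.ne', fun h => absurd h hgt.ne'⟩,
        ⟨fun h => absurd h (not_lt.2 hpos.le), fun h => absurd h (not_lt.2 hgt.le)⟩⟩
  refine ⟨?_, ?_, ?_⟩ <;> ext x <;> simp only [mem_setOf_eq]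
  · by_cases hx : x = p0 s
    · rw [hx, sub_self, norm_zero, prof_zero]
      exact ⟨fun _ => by positivity, fun _ => hp0.le⟩
    · exact (key x hx).1
  · by_cases hx : x = p0 s
    · rw [hx, sub_self, norm_zero, prof_zero]
      constructor
      · intro h; exact absurd h hp0.ne
      · intro h; exact absurd h (by positivity)
    · exact (key x hx).2.1
  · by_cases hx : x = p0 s
    · rw [hx, sub_self, norm_zero, prof_zero]
      exact ⟨fun _ => by positivity, fun _ => hp0⟩
    · exact (key x hx).2.2

/-- **The model diffeomorphism** `Φ_M : ℝ³ ≅ ℝ³`, `Φ_M(y) = p₀ + μ(y) y`, carrying the closed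
unit ball onto `M = {F_M ≤ 0}`, the unit sphere onto `∂M = {F_M = 0}` and the open ball onto
`{F_M < 0}`. [cite: Schultens2014, Lemma 3.2.3 (PDF p. 43)] -/
theorem exists_modelDiffeo :
    ∃ Φ : EuclideanSpace ℝ (Fin 3) ≃ₘ⟮𝓘(ℝ, EuclideanSpace ℝ (Fin 3)), 𝓘(ℝ, EuclideanSpace ℝ (Fin 3))⟯
      EuclideanSpace ℝ (Fin 3),
      (∀ y, Φ y = RadialBallMap.rmap (p0 s) (prof P s) (s / 8) y) ∧
      Φ '' closedBall 0 1 = {x | FM P s x ≤ 0} ∧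
      Φ '' sphere 0 1 = {x | FM P s x = 0} ∧
      Φ '' ball 0 1 = {x | FM P s x < 0} := by
  have hprof := isProfile hP hP0 hP1 hPd' hPge hPle hs hs1
  obtain ⟨Φ, hΦ⟩ := RadialBallMap.exists_diffeomorph hprof (p0 s)
  obtain ⟨e1, e2, e3⟩ := setOf_FM_cmp hP hP0 hP1 hPd' hPge hPle hs hs1
  have hfun : (Φ : EuclideanSpace ℝ (Fin 3) → EuclideanSpace ℝ (Fin 3)) =
      RadialBallMap.rmap (p0 s) (prof P s) (s / 8) := funext hΦ
  refine ⟨Φ, hΦ, ?_, ?_, ?_⟩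
  · rw [hfun, RadialBallMap.image_closedBall hprof, e1]
  · rw [hfun, RadialBallMap.image_sphere hprof, e2]
  · rw [hfun, RadialBallMap.image_ball hprof, e3]

end Profile

section Agreement

variable (hP0 : ∀ t, t ≤ -1 → P t = 0) (hPge : ∀ t, max 0 t ≤ P t) (hPle : ∀ t, P t ≤ max 0 t + 1)
  (hs : 0 < s)
include hP0 hPge hPle hs

omit hPge hPle in
/-- **Agreement with the lid function**: `F_M = G` wherever `x₂ ≥ -s/2` and `G ≥ -s/4`.
[folklore] -/
theorem FM_eq_lidFun {x : EuclideanSpace ℝ (Fin 3)} (hz : -(s / 2) ≤ x 2) (hG : -(s / 4) ≤ lidFun P s x) :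
    FM P s x = lidFun P s x := by
  have hl : lid' P s x = lidFun P s x := lid'_eq_lidFun hs (by linarith)
  unfold FM
  rw [hl]
  have harg : (bot s x - lidFun P s x) / (s / 8) ≤ -1 := by
    rw [div_le_iff₀ (by positivity)]; unfold bot; linarith
  rw [hP0 _ harg, mul_zero, add_zero]

/-- **Agreement of the solids above height `-s/2`**: there `F_M ≤ 0 ↔ G ≤ 0`, `F_M = 0 ↔ G = 0`,
`F_M < 0 ↔ G < 0`. [folklore] -/
theorem FM_iff_lidFun {x : EuclideanSpace ℝ (Fin 3)} (hz : -(s / 2) ≤ x 2) :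
    (FM P s x ≤ 0 ↔ lidFun P s x ≤ 0) ∧ (FM P s x = 0 ↔ lidFun P s x = 0) ∧
      (FM P s x < 0 ↔ lidFun P s x < 0) := by
  by_cases hG : -(s / 4) ≤ lidFun P s x
  · rw [FM_eq_lidFun hP0 hs hz hG]; exact ⟨Iff.rfl, Iff.rfl, Iff.rfl⟩
  · push Not at hG
    have hl : lid' P s x = lidFun P s x := lid'_eq_lidFun hs (by linarith)
    have hF := (FM_bounds hPge hPle hs x (P := P)).2
    rw [hl] at hF
    have hbot : bot s x ≤ -(s / 2) := by unfold bot; linarith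
    have hm : max (lidFun P s x) (bot s x) ≤ -(s / 4) := max_le hG.le (by linarith)
    have hFM : FM P s x < 0 := by linarith
    exact ⟨⟨fun _ => hG.le.trans (by linarith), fun _ => hFM.le⟩,
      ⟨fun h => absurd h hFM.ne, fun h => absurd h (by linarith)⟩, ⟨fun _ => by linarith, fun _ => hFM⟩⟩

end Agreement

end Literature.Topology.FourManifolds.DomeModel
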